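import Mathlib
import HarnessLib
import HarnessLib.Audit
import Summits.QuantumFields.Statement

/-!
Route: DoublingDefect

DORMANT since 2026-09-05T00:14:27Z (reconciler: no traction for 5 d (last activity statement-checked at 2026-08-30T23:36:16Z); parked, not closed — `ledger route dormant route-QuantumFields-DoublingDefect --off` to reactivate) — unstaffed, not closed; items shared with open routes are served there. `ledger route dormant <id> --off` reactivates.

# Route DoublingDefect — purity-defect squaring across torus doublings — a boundary-free,
centre-free one-scale exit for the lattice gap (2001 A19.1.ot)

It suffices to show X = OneTorusExit ∧ DoublingRecursion for every SIMPLY-CONNECTED compact simple G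
(together with the provable-grade
glue RecursionToGap, the shared item NonSimplyConnectedLatticeGap (stmt-QuantumFields-16405) for the
remaining groups and the shared
existence leg ContinuumLegGivenGap (stmt-QuantumFields-15828)). The object is the PERIOD-DOUBLING
(purity) DEFECT of Wilson's theory in
the faithful representation r on the anisotropic four-torus (ℤ/L)³×(ℤ/t): δ_β(L) := 1 −
Z_β(L,L,L,2L)/Z_β(L,L,L,L)² = 1 − Tr ρ_L²,
ρ_L = T_L^L/Tr T_L^L ≥ 0 (Lüscher's transfer matrix) — two partition functions, no observable, no
boundary condition, no centre twist.
OneTorusExit (rank 2): at every large β, for every ε, arbitrarily large scales L with δ_β(L) ≤ ε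
exist (the aspect-≤2 thermal state is
ε-pure at ONE scale). DoublingRecursion (rank 3): δ_β(L′) ≤ C·δ_β(L)² for all L′ ∈ [2L,4L] (the
defect squares under doubling).
RESURRECT-2001 of node A19.1.ot (walls onetorus W_u ∧ dblrec W″; route
ym-w-volume-uniform-expcbeta/period-doubling-defect), re-typed
into today's Statement; no idea card is realised (novel-route lens resurrect).
Lean: `OneTorusExit ∧ DoublingRecursion ∧ RecursionToGap ∧ NonSimplyConnectedLatticeGap ∧
ContinuumLegGivenGap`

## Assembly
Pure logic (theorem `closes` in Sketch.lean = glue.lean, sorry-free, axioms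
propext/Classical.choice/Quot.sound): fix a compact simple G
with its Borel σ-algebra; ContinuumLegGivenGap reduces YangMills for G to the UniformLatticeGap body
for every faithful r; if G is simply
connected, RecursionToGap applied to DoublingRecursion and OneTorusExit (instantiated at G, r)
returns that body; otherwise
NonSimplyConnectedLatticeGap is the body.

Rationale: WHY THIS LINE. Mechanism: since Z_β(a,a,a,t) = Tr T_a^t with T_a ≥ 0 (Luscher1977,
OsterwalderSeilerAnnPhys1978), δ_β(L) is the collision-probability
defect of the Boltzmann weights at temperature 1/L; exit + recursion iterate to δ_β(2^k L*) ≤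
(Cδ*)^(2^k)/C, i.e. −log δ grows LINEARLY in
the scale, which is a volume-uniform transfer gap m(β) ≥ c/L*(β) and hence the UniformLatticeGap
body (RecursionToGap, spectral theory with
the thermal error controlled by δ itself). Imported: finite-size scaling of torus free energies and
gaps (PrivmanFisher1983, Luscher1986,
BorgsKotecky1990, Borgs1993) and the one-scale-threshold philosophy of local-gap criteria
(Knabe1988, GossetMozgunov2016) from statistical
mechanics / quantum spin systems, run on partition functions instead of Hamiltonians. What it does
that listed routes do not: the criterion
object needs NO boundary condition (OneCertifiedCube's TV condition quantifies over all exterior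
data, exposed to rough boundary fields), NO
centre (FluxBootstrap / MarginalTwistOnset need Z(G) ≠ 1 and delegate centreless G to a
summit-strength support) and NO observable (the closed
card pressure-boltzmann-gap-criterion had the currency but no propagation mechanism — its K1 was the
gap itself); the propagation lemma is
STRICTLY WEAKER than the gap (U(1)₄ and SO(3) satisfy it) and was claim-proved in 2001 in a
time-shifted form (ym-w-dblrec W″ @3f22a252,
unrefereed — an unpublished internal dependency, therefore filed here as a CRUX, not assumed).

RANKED CRUXES. #2 OneTorusExit (crux) — for every simply-connected compact simple G and faithful
unitary r, for every ε > 0 there is β₁ such that for all β ≥ β₁ and every L₀ there is L ≥ L₀ with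
δ_β(L) ≤ ε (2001 wall onetorus W_u; crux (K_u)). [difficulty: open-problem] (why it might fail: It
is the weak-coupling lattice gap seen at ONE scale: vacuum dominance of the aspect-≤2 thermal state
needs L ≳ ξ(β) ~ e^(cβ), beyond every expansion; U(1)₄ fails it (photon gas: δ ≡ δ* > 0), so any
proof must use the non-abelian group.) [Luscher1977, PrivmanFisher1983, Luscher1986,
BorgsKotecky1990, ChatterjeeYMProb2019, Balaban1989LargeFieldII]
#3 DoublingRecursion (crux) — for every simply-connected compact simple G and faithful r there are C
> 0, β₀, L₀ with δ_β(L′) ≤ C·δ_β(L)² for all β ≥ β₀, L ≥ L₀, L′ ∈ [2L,4L] (2001 wall dblrec W″,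
plain purity-defect form). [difficulty: L] (why it might fail: 2001 proved only a TIME-SHIFTED
variant (u₀, constant 7.4·10⁴K⁶, claim-level, unrefereed); a torus gap dropping under spatial
doubling faster than O(log L/L) while δ(L) is already small (light states fitting only the bigger
box) breaks the plain form.) [Luscher1977, OsterwalderSeilerAnnPhys1978, Borgs1993, Knabe1988,
GossetMozgunov2016, TomboulisYaffe1985]
#4 NonSimplyConnectedLatticeGap (crux) — (SHARED VERBATIM with route ConvexGribovBody,
stmt-QuantumFields-16405) the volume-uniform weak-coupling lattice gap for compact simple G with
π₁(G) ≠ 1 and every faithful r — the groups whose magnetic-flux vacua make δ_β(L) → 1 −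
|H²(T³;π₁G)|⁻¹, so the δ-criterion cannot see their (expected) local clustering. [difficulty:
open-problem] (why it might fail: It is the target for SO(3)-type groups: local observables must
cluster volume-uniformly across |H²(T³;π₁G)| near-degenerate flux vacua on top of the weak-coupling
gap itself; nothing rigorous beyond strong coupling.) [tHooft1979Flux, KovacsTomboulis2000,
ChatterjeeYMProb2019]
#5 ContinuumLegGivenGap (crux) — (SHARED VERBATIM, stmt-QuantumFields-15828, the existence leg) for
every compact simple G: the volume-uniform weak-coupling lattice gap for every faithful r implies
the G-clause of YangMills along a weak-coupling scheme (β_k → ∞, a_k ∝ m(β_k)). [difficulty: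
open-problem] (why it might fail: Existence half of the problem: E0–E4 + IsYangMillsFor for ALL
species lie beyond Bałaban's UV stability; if ξ(β) stayed bounded every weak-coupling limit would be
ultralocal ⇒ Gaussian, IsNonGaussian fails.) [JaffeWitten2000, Balaban1989LargeFieldII,
ChatterjeeYMProb2019]
#9 RecursionToGap (support) — for simply-connected compact simple G and faithful r: recursion ∧ exit
(the two crux bodies, pointwise in (G,r)) ⇒ the UniformLatticeGap body for (G,r): ∃β₂ ∀β≥β₂ ∃m>0 ∃S₁
∀A,B ∃C: |latticeConnectedCorr r.ρ β (2S+1) A B n| ≤ C e^(−mn) for S ≥ S₁, n ≤ S. Intended proof: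
identify Z(2S+1,·) with the trace of Lüscher's transfer matrix of the tree's torus Wilson measure;
iterate the recursion from an exit scale L* with δ ≤ 1/(4C) to get −log δ_β(L) ≥ cL/L* for all L ≥
2L*; λ₁/λ₀ ≤ (2δ)^(1/L) gives the gap m ≥ c/(4L*); spectral decomposition on the (2S+1)-periodic
torus with the thermal error Tr T^P/λ₀^P − 1 ≤ δ/(1−δ). [difficulty: L] [Luscher1977,
OsterwalderSeilerAnnPhys1978, Seiler1982]

TWO-LAYER PLAN. Foreseen glued splits (nothing filed now): OneTorusExit ⇐ ZtPositive →
FreeEnergyWindow → OneTorusExit (bc/OneTorusExit_birth.lean: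
|log Z(L⁴) + fL⁴| ≤ ε ∧ |log Z(L³×2L) + 2fL⁴| ≤ ε at one scale; glue proved there); FreeEnergyWindow
⇐ Bałaban free-energy bounds on
tori of side ≤ 4L with winding-sector isolation at the last scale — the 2001 (FE⁰) door.
DoublingRecursion ⇐ DefectRange (RP: 0 ≤ δ ≤ 1)
→ SmallDefectRecursion → DoublingRecursion (bc/DoublingRecursion_birth.lean, glue proved);
SmallDefectRecursion ⇐ GapNonCollapse
(m(L′) ≥ m(L) − c·log L/L for L′ ∈ [2L,4L]) + thermal multiplicity bound; alternative child: the
2001 time-shifted form W″.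

KILL CRITERIA. DoublingRecursion refuted for a simply-connected G (a sequence (β,L_j,L′_j) with
δ(L′_j)/δ(L_j)² → ∞) ⇒ pivot ONCE to the 2001 time-shifted
defect u₀ (restate as DoublingRecursionTS); refuted again ⇒ close refuted:DoublingRecursion.
OneTorusExit refuted (δ_β(L) ≥ δ* > 0 for all
L at arbitrarily large β, some SU(N)) = a massless / non-vacuum-dominated weak-coupling phase ⇒
close the route AND file the witness against
UniformLatticeGap (stmt-8778) — a summit-level negative. RecursionToGap refuted ⇒ convention
mismatch between the inlined Z and the tree's
wilsonMeasure: repair the glue (restate), not the line. Mooted if UniformLatticeGap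
(stmt-QuantumFields-8778) is proved by any other route.

NOT DECOMPOSED YET. The transfer-matrix identification Z(2S+1,·) = Tr T^t for the tree's torus
measure (Lüscher's construction is not yet a tree object), the
strong-coupling instance of the exit (cluster expansion with winding polymers), the femto-regime
value of δ (toron/zero-mode asymptotics)
and every RG input to FreeEnergyWindow are layer-2 children; constants (C, η, L*) are deliberately
existential.

CHEAPEST FALSIFIER. (i) Monte-Carlo δ_β(L) for SU(2), β ∈ (2.3, 2.5), L ∈ (4,6,8,12,16): 1 − δ =
Z(L³×2L)/Z(L⁴)² by thermodynamic integration of ⟨S⟩ in β for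
both shapes (one kit job, O(10²–10³) core-h): expected δ ≈ 1 − O(N⁻³) in the femto regime falling
below 10⁻² by L ≈ 2ξ; a plateau
δ ≥ δ* over all L at β = 2.5 kills the exit's plausibility; δ(2L)/δ(L)² growing without bound kills
the plain recursion (not run here: hub
is compute-free and the refuter owns it). (ii) Closed form for the free photon gas: δ_U(1)(L) → δ* ∈
(0,1) (shape-only by scale
invariance) — confirms the exit has U(1)-teeth. (iii) In Lean, done: β = 0 gives Z ≡ 1, δ ≡ 0
(bc/special.lean rc 0, no sorry).

NUMBERS. δ ∈ [0,1) always (Tr T^(2L) ≤ (Tr T^L)², T ≥ 0: Luscher1977). Massive regime: δ_β(L) ≈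
2n₁(L)e^(−m(β)L), δ(2L)/δ(L)² ~ (mL)^(−3/2).
Torelon window: δ ~ e^(−σL²) ⇒ δ(2L) ~ δ(L)⁴. π₁(G) ≠ 1: δ → 1 − |H²(T³;π₁G)|⁻¹ (SO(3): 7/8). Free
photon gas: δ ≡ δ* (aspect-ratio
constant). 2001 dblrec W″: δ_β(L′) ≤ 7.4·10⁴K⁶u₀² (claim-level). Plaquette counts: (L³·2L)·6 =
2·6L⁴, so the bulk free energy cancels in δ.

DEFINITION REQUESTS. None blocking (all vocabulary inlined over haarProbability / LatticeRep /
Mathlib). Wanted later as Literature definitions for the provers of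
RecursionToGap: the anisotropic-torus Wilson partition function and Lüscher's positive transfer
matrix for `wilsonMeasure` on (ℤ/(2S+1))⁴
(notion `transfer_matrix`, recorded absent in ConstructiveQFTWave0); to be filed with `ledger
workitem add --kind definition` after open.

Novelty: Searches (2026-08-17): lit search --source crossref ×5 ("Knabe finite size criterion spectral gap":
6 hits, Anshu 2020; "local gap threshold
frustration-free Gosset Mozgunov": 6, GossetMozgunov2016; "rigorous theory of finite-size scaling
first-order Borgs Kotecky": 5,
BorgsKotecky1990, Borgs1993; "selfadjoint strictly positive transfer matrix lattice gauge Luscher":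
4, Luscher1977; "Privman Fisher
finite-size 1983": 5, PrivmanFisher1983); lit galaxy search "finite-size scaling of the mass gap"
--star all (0), "phenomenological
renormalization" --star all (12, Henkel's book, none on gauge tori), "vacuum dominance" --star pdf
(2, irrelevant); local searchd /
openalex / arxiv unavailable this session (connection reset / HTTP 429 — recorded); lean search +
bc/dedup.lean exact? over Mathlib + 23
Literature modules + 24 YangMills Theses (no hit); 2001 archive: walls ym-w-onetorus / ym-w-dblrec,
route period-doubling-defect (internal,
unrefereed); today's closed card pressure-boltzmann-gap-criterion (declined:vacuous, grade variant)
read in full.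
Nearest prior art found: PrivmanFisher1983 / Luscher1986 (finite-size free energies and spectra of
tori: gap ⇔ e^(−L/ξ) corrections — the
converse direction); BorgsKotecky1990, Borgs1993 (phase counting and mass-gap finite-size scaling
from partition-function ratios at
first-order points); Knabe1988, GossetMozgunov2016 (one-scale gap thresholds for frustration-free
Hamiltonians); on this hub
OneCertifiedCube.CrossoverCertificate (TV/DS fin  [refs: GossetMozgunov2016, BorgsKotecky1990, Borgs1993, Luscher1977, PrivmanFisher1983, Luscher1986, Knabe1988]

Barriers (technique_class: finite-size-criterion, reflection-positivity): - technique_class: finite-size-criterion, reflection-positivity, transfer-matrix-spectral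
- Literature.Barriers.QuantumFields.AbelianDeconfinementD4: evaded at the right item — for U(1)₄ at
weak coupling the photon gas makes δ_β(L) ≡ δ* > 0 (shape-only), so OneTorusExit is U(1)-FALSE while
DoublingRecursion and RecursionToGap are U(1)-true; any proof of the exit must use the non-abelian
group.
- Literature.Barriers.QuantumFields.FiniteTemperatureDeconfinement: δ uses aspect ratios 1 and 2 on
tori with three equal sides only, never thin slabs; in the deconfined/femto regime δ = O(1) and the
exit is simply not claimed there (∃L).
- Literature.Barriers.QuantumFields.FixedCouplingUltralocality: not met — the continuum limit is
taken inside the shared leg along β_k → ∞ with a_k ∝ m(β_k); no fixed-β limit.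
- Literature.Barriers.QuantumFields.UVStabilityNonUniqueness: conceded and harmless — sequential
limits (ruling Y2) inside ContinuumLegGivenGap.
- Literature.Barriers.QuantumFields.PerturbativeInvisibility: it does not evade it; the bet is that
the exit scale L* ~ ξ(β) can be certified by free-energy bounds at ONE non-perturbative scale
(Bałaban chain + one step), never by resumming perturbation theory.
- Literature.Barriers.QuantumFields.EguchiKawaiBreakdown: the femto-torus zero-mode/toron physics
that broke finite-volume association (GluonFreeDual) only says δ = O(1) below the crossover; the
line never asserts smallness there.
- Literature.Barriers.QuantumFields.MigdalKadanoff

History (route lifecycle, newest last):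
- 2026-08-25T11:53:59Z · DORMANT — reconciler: no traction for 7.7 d (last activity item-evidence-added at 2026-08-17T19:14:14Z); parked, not closed — `ledger route dormant route-QuantumFields-Do (operator:999:1611066)
- 2026-08-28T21:14:16Z · REACTIVATED — reconciler: reactivated — activity statement-closed at 2026-08-28T18:47:32Z after parking at 2026-08-25T11:53:59Z (operator:999:2199491)
- 2026-09-05T00:14:27Z · DORMANT — reconciler: no traction for 5 d (last activity statement-checked at 2026-08-30T23:36:16Z); parked, not closed — `ledger route dormant route-QuantumFields-Doubli (operator:999:536597)

sub-problem: YangMills · status: dormant · opened planner-plan-lens3-QuantumFields-resurrect-0 2026-08-17T02:08:02Z · rev 3 · ledger route-QuantumFields-DoublingDefect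
GENERATED by the gate from the ledger (D-0016/17). Provers cite these decls: `theorem foo : Summit.QuantumFields.YangMills.Theses.DoublingDefect.<Decl> := …` in Summits/QuantumFields/YangMills/Theorems/<Name>.lean.
-/

namespace Summit.QuantumFields.YangMills.Theses.DoublingDefect

open scoped BigOperators Topology Manifold Classical MeasureTheory ProbabilityTheory Matrix InnerProductSpace ComplexConjugate ContinuousMap
open Filter Set Function TopologicalSpace MeasureTheory

attribute [summit_statement] _root_.YangMills

/-- item stmt-QuantumFields-17753 · crux · rank 2 · open · by planner
why it might fail: It is the weak-coupling lattice gap seen at ONE scale: vacuum dominance of the aspect-≤2 thermal state needs L ≳ ξ(β) ~ e^(cβ), beyond every expansion; U(1)₄ fails it (photon gas: δ ≡ δ* > 0), so any proof must use the non-abelian group.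
sources: Luscher1977, PrivmanFisher1983, Luscher1986, BorgsKotecky1990, ChatterjeeYMProb2019, Balaban1989LargeFieldII
[crux] for every simply-connected compact simple G and faithful unitary r, for every ε > 0 there is
β₁ such that for all β ≥ β₁ and every L₀ there is L ≥ L₀ with δ_β(L) ≤ ε (2001 wall onetorus W_u;
crux (K_u)). [difficulty: open-problem] -/
@[route_item "route-QuantumFields-DoublingDefect"]
def OneTorusExit : Prop :=
  ∀ (G : Type) [Group G] [TopologicalSpace G] [IsTopologicalGroup G] [CompactSpace G] [MeasurableSpace G] [BorelSpace G], Literature.MathematicalPhysics.QuantumFieldTheory.IsCompactSimpleLieGroup G → SimplyConnectedSpace G → ∀ r : Literature.MathematicalPhysics.QuantumFieldTheory.LatticeRep G, let Z : ℝ → ℕ → ℕ → ℝ := fun β a t => let St := Fin a × Fin a × Fin a × Fin t; let sh : St → Fin 4 → St := fun x μ => ![(finRotate a x.1, x.2.1, x.2.2.1, x.2.2.2), (x.1, finRotate a x.2.1, x.2.2.1, x.2.2.2), (x.1, x.2.1, finRotate a x.2.2.1, x.2.2.2), (x.1, x.2.1, x.2.2.1, finRotate t x.2.2.2)] μ; let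 pl : (St × Fin 4 → G) → St → Fin 4 → Fin 4 → G := fun U x μ ν => U (x, μ) * U (sh x μ, ν) * (U (sh x ν, μ))⁻¹ * (U (x, ν))⁻¹; ∫ U, Real.exp (-β * ∑ x : St, ∑ q : {q : Fin 4 × Fin 4 // q.1 < q.2}, ((r.N : ℝ) - (r.ρ (pl U x q.1.1 q.1.2)).trace.re)) ∂(Measure.pi fun _ : St × Fin 4 => Literature.MathematicalPhysics.QuantumFieldTheory.haarProbability G); let δ : ℝ → ℕ → ℝ := fun β L => 1 - Z β L (2 * L) / (Z β L L) ^ 2; ∀ ε : ℝ, 0 < ε → ∃ β₁ : ℝ, ∀ β : ℝ, β₁ ≤ β → ∀ L₀ : ℕ, ∃ L : ℕ, L₀ ≤ L ∧ δ β L ≤ ε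

/-- item stmt-QuantumFields-17754 · crux · rank 3 · open · by planner
why it might fail: 2001 proved only a TIME-SHIFTED variant (u₀, constant 7.4·10⁴K⁶, claim-level, unrefereed); a torus gap dropping under spatial doubling faster than O(log L/L) while δ(L) is already small (light states fitting only the bigger box) breaks the plain form.
sources: Luscher1977, OsterwalderSeilerAnnPhys1978, Borgs1993, Knabe1988, GossetMozgunov2016, TomboulisYaffe1985
[crux] for every simply-connected compact simple G and faithful r there are C > 0, β₀, L₀ with
δ_β(L′) ≤ C·δ_β(L)² for all β ≥ β₀, L ≥ L₀, L′ ∈ [2L,4L] (2001 wall dblrec W″, plain purity-defect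
form). [difficulty: L] -/
@[route_item "route-QuantumFields-DoublingDefect"]
def DoublingRecursion : Prop :=
  ∀ (G : Type) [Group G] [TopologicalSpace G] [IsTopologicalGroup G] [CompactSpace G] [MeasurableSpace G] [BorelSpace G], Literature.MathematicalPhysics.QuantumFieldTheory.IsCompactSimpleLieGroup G → SimplyConnectedSpace G → ∀ r : Literature.MathematicalPhysics.QuantumFieldTheory.LatticeRep G, let Z : ℝ → ℕ → ℕ → ℝ := fun β a t => let St := Fin a × Fin a × Fin a × Fin t; let sh : St → Fin 4 → St := fun x μ => ![(finRotate a x.1, x.2.1, x.2.2.1, x.2.2.2), (x.1, finRotate a x.2.1, x.2.2.1, x.2.2.2), (x.1, x.2.1, finRotate a x.2.2.1, x.2.2.2), (x.1, x.2.1, x.2.2.1, finRotate t x.2.2.2)] μ; let pl : (St × Fin 4 → G) → St → Fin 4 → Fin 4 → G := fun U x μ ν => U (x, μ) * U (sh x μ, ν) * (U (sh x ν, μ))⁻¹ * (U (x, ν))⁻¹; ∫ U, Real.exp (-β * ∑ x : St, ∑ q : {q : Fin 4 × Fin 4 // q.1 < q.2}, ((r.N : ℝ) - (r.ρ (pl U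 x q.1.1 q.1.2)).trace.re)) ∂(Measure.pi fun _ : St × Fin 4 => Literature.MathematicalPhysics.QuantumFieldTheory.haarProbability G); let δ : ℝ → ℕ → ℝ := fun β L => 1 - Z β L (2 * L) / (Z β L L) ^ 2; ∃ C β₀ : ℝ, ∃ L₀ : ℕ, 0 < C ∧ ∀ β : ℝ, β₀ ≤ β → ∀ L : ℕ, L₀ ≤ L → ∀ L' : ℕ, 2 * L ≤ L' → L' ≤ 4 * L → δ β L' ≤ C * (δ β L) ^ 2

/-- item stmt-QuantumFields-16405 · crux · rank 4 · open · by planner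
why it might fail: It is the target for SO(3)-type groups: local observables must cluster volume-uniformly across |H²(T³;π₁G)| near-degenerate flux vacua on top of the weak-coupling gap itself; nothing rigorous beyond strong coupling.
sources: tHooft1979Flux, KovacsTomboulis2000, ChatterjeeYMProb2019
[crux] (NEW 2026-08-16, route-choice repair; reviewer's repair R2) the UniformLatticeGap body for
compact simple G with ¬SimplyConnectedSpace G (SO(3) = PSU(2), PSU(N), SO(N ≥ 3), SU(4)/ℤ₂,
Sp(N)/ℤ₂, E₆/ℤ₃, E₇/ℤ₂, …) and every faithful unitary r: there is β₀ with, for all β ≥ β₀, m > 0 and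
S₁ such that all pairs of gauge-invariant local observables A, B satisfy |⟨A·τ_n B⟩ − ⟨A⟩⟨B⟩| ≤
C_{A,B} e^{−m n} on every torus (2S+1)⁴, S ≥ S₁, n ≤ S, under Wilson's measure at coupling β. These
are exactly the groups where the route's slice-Poincaré mechanism provably cannot work
(poincareHypothesis_unsatisfiable_of_sliceBottleneckAt, modulo the light magnetic-flux sectors m ∈
H²(T³; π₁G): tHooft1979Flux; Z₋/Z₊ → 1, Greensite2011 §4.4; DeforcrandJahn2003 §§4–6). Natural
mechanism (not typed yet): the periodic (G, r)-theory is the (G̃, r∘π)-theory, a mixture over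
|H²(T³; π₁G)| flux sectors up to a dilute gas of π₁-monopoles of action ≥ c₀β per unit length;
per-sector gap (e.g. a sector-conditioned Poincaré inequality E Var(f | m) ≤ C·Dmax·dir f,
reviewer's R1) + sector-blindness of local observables at rate ≥ m (flux energies ~ e^{−ρS²} in the
confined phase) ⇒ the clustering bound. closes uses -/
@[route_item "route-QuantumFields-DoublingDefect"]
def NonSimplyConnectedLatticeGap : Prop :=
  ∀ (G : Type) [Group G] [TopologicalSpace G] [IsTopologicalGroup G] [CompactSpace G] [MeasurableSpace G] [BorelSpace G], Literature.MathematicalPhysics.QuantumFieldTheory.IsCompactSimpleLieGroup G → ¬ SimplyConnectedSpace G → ∀ r : Literature.MathematicalPhysics.QuantumFieldTheory.LatticeRep G, ∃ β₀ : ℝ, ∀ β : ℝ, β₀ ≤ β → ∃ m : ℝ, 0 < m ∧ ∃ S₁ : ℕ, ∀ A B : Literature.MathematicalPhysics.QuantumFieldTheory.YMSpecies G, ∃ C : ℝ, ∀ S n : ℕ, S₁ ≤ S → n ≤ S → |Literature.MathematicalPhysics.QuantumFieldTheory.latticeConnectedCorr r.ρ β (2 * S + 1) A.F B.F n| ≤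 C * Real.exp (-(m * n))

/-- item stmt-QuantumFields-15828 · crux · rank 5 · open · by operator
why it might fail: Existence half of the problem: E0–E4 + IsYangMillsFor for ALL species lie beyond Bałaban's UV stability; if ξ(β) stayed bounded every weak-coupling limit would be ultralocal ⇒ Gaussian, IsNonGaussian fails.
sources: JaffeWitten2000, Balaban1989LargeFieldII, ChatterjeeYMProb2019
[crux] (existence leg, RE-TYPED for the 2026-08-16 Statement) for every compact simple Lie group G:
IF for every faithful unitary r the volume-uniform weak-coupling lattice gap holds
(UniformLatticeGap body for G, Borel σ-algebra), THEN there are r, a sequential scheme sch WITH β_k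
→ ∞ (`sch.HasWeakCouplingLimit`) and OS data T with IsYangMillsFor r sch T, T non-trivial and
non-Gaussian in tr F², and Δ > 0 with T.HasMassGap Δ ∧ HasLatticeMassGap r sch Δ. Intended use: a_k
∝ m(β_k) with β_k → ∞ (ξ(β) → ∞ is 2001-refereed and hub-filed: DirichletWindow /
XiCompleteMonotonicity), joint continuum limit with E0–E4 at that scale (Bałaban UV control, E1 by
any of the hub's rotation routes), non-triviality from the curvature three/four-point function.
[deps: UniformLatticeGap] [difficulty: open-problem] -/
@[route_item "route-QuantumFields-DoublingDefect"]
def ContinuumLegGivenGap : Prop :=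
  ∀ (G : Type) [Group G] [TopologicalSpace G] [IsTopologicalGroup G] [CompactSpace G], Literature.MathematicalPhysics.QuantumFieldTheory.IsCompactSimpleLieGroup G → letI : MeasurableSpace G := borel G; haveI : BorelSpace G := ⟨rfl⟩; (∀ r : Literature.MathematicalPhysics.QuantumFieldTheory.LatticeRep G, ∃ β₀ : ℝ, ∀ β : ℝ, β₀ ≤ β → ∃ m : ℝ, 0 < m ∧ ∃ S₁ : ℕ, ∀ A B : Literature.MathematicalPhysics.QuantumFieldTheory.YMSpecies G, ∃ C : ℝ, ∀ S n : ℕ, S₁ ≤ S → n ≤ S → |Literature.MathematicalPhysics.QuantumFieldTheory.latticeConnectedCorr r.ρ β (2 * S + 1) A.F B.F n| ≤ C * Real.exp (-(m * n))) → ∃ (r : Literature.MathematicalPhysics.QuantumFieldTheory.LatticeRep G) (sch : Literature.MathematicalPhysics.QuantumFieldTheory.SpeciesScheme (Literature.MathematicalPhysics.QuantumFieldTheory.YMSpecies G)) (T : Literature.MathematicalPhysics.QuantumFieldTheory.OSData (Literature.MathematicalPhysics.QuantumFieldTheory.YMSpecies G) 4), sch.HasWeakCouplingLimit ∧ Literature.MathematicalPhysics.QuantumFieldTheory.IsYangMillsFor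 r sch T ∧ T.IsNontrivial r.curvature ∧ T.IsNonGaussian r.curvature ∧ ∃ Δ > 0, T.HasMassGap Δ ∧ Literature.MathematicalPhysics.QuantumFieldTheory.HasLatticeMassGap r sch Δ

/-- item stmt-QuantumFields-17755 · support · rank 9 · open · by planner
sources: Luscher1977, OsterwalderSeilerAnnPhys1978, Seiler1982
[support] for simply-connected compact simple G and faithful r: recursion ∧ exit (the two crux
bodies, pointwise in (G,r)) ⇒ the UniformLatticeGap body for (G,r): ∃β₂ ∀β≥β₂ ∃m>0 ∃S₁ ∀A,B ∃C:
|latticeConnectedCorr r.ρ β (2S+1) A B n| ≤ C e^(−mn) for S ≥ S₁, n ≤ S. Intended proof: identify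
Z(2S+1,·) with the trace of Lüscher's transfer matrix of the tree's torus Wilson measure; iterate
the recursion from an exit scale L* with δ ≤ 1/(4C) to get −log δ_β(L) ≥ cL/L* for all L ≥ 2L*;
λ₁/λ₀ ≤ (2δ)^(1/L) gives the gap m ≥ c/(4L*); spectral decomposition on the (2S+1)-periodic torus
with the thermal error Tr T^P/λ₀^P − 1 ≤ δ/(1−δ). [difficulty: L] -/
@[route_item "route-QuantumFields-DoublingDefect"]
def RecursionToGap : Prop :=
  ∀ (G : Type) [Group G] [TopologicalSpace G] [IsTopologicalGroup G] [CompactSpace G] [MeasurableSpace G] [BorelSpace G], Literature.MathematicalPhysics.QuantumFieldTheory.IsCompactSimpleLieGroup G → SimplyConnectedSpace G → ∀ r : Literature.MathematicalPhysics.QuantumFieldTheory.LatticeRep G, let Z : ℝ → ℕ → ℕ → ℝ := fun β a t => let St := Fin a × Fin a × Fin a × Fin t; let sh : St → Fin 4 → St := fun x μ => ![(finRotate a x.1, x.2.1, x.2.2.1, x.2.2.2), (x.1, finRotate a x.2.1, x.2.2.1, x.2.2.2), (x.1, x.2.1, finRotate a x.2.2.1, x.2.2.2), (x.1, x.2.1,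 x.2.2.1, finRotate t x.2.2.2)] μ; let pl : (St × Fin 4 → G) → St → Fin 4 → Fin 4 → G := fun U x μ ν => U (x, μ) * U (sh x μ, ν) * (U (sh x ν, μ))⁻¹ * (U (x, ν))⁻¹; ∫ U, Real.exp (-β * ∑ x : St, ∑ q : {q : Fin 4 × Fin 4 // q.1 < q.2}, ((r.N : ℝ) - (r.ρ (pl U x q.1.1 q.1.2)).trace.re)) ∂(Measure.pi fun _ : St × Fin 4 => Literature.MathematicalPhysics.QuantumFieldTheory.haarProbability G); let δ : ℝ → ℕ → ℝ := fun β L => 1 - Z β L (2 * L) / (Z β L L) ^ 2; (∃ C β₀ : ℝ, ∃ L₀ : ℕ, 0 < C ∧ ∀ β : ℝ, β₀ ≤ β → ∀ L : ℕ, L₀ ≤ L → ∀ L' : ℕ, 2 * L ≤ L' → L' ≤ 4 * L → δ β L' ≤ C * (δ β L) ^ 2) → (∀ ε : ℝ, 0 < ε → ∃ β₁ : ℝ, ∀ β : ℝ, β₁ ≤ β → ∀ L₀ : ℕ, ∃ L : ℕ, L₀ ≤ L ∧ δ β L ≤ ε) → ∃ β₂ : ℝ, ∀ β : ℝ, β₂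 ≤ β → ∃ m : ℝ, 0 < m ∧ ∃ S₁ : ℕ, ∀ A B : Literature.MathematicalPhysics.QuantumFieldTheory.YMSpecies G, ∃ C : ℝ, ∀ S n : ℕ, S₁ ≤ S → n ≤ S → |Literature.MathematicalPhysics.QuantumFieldTheory.latticeConnectedCorr r.ρ β (2 * S + 1) A.F B.F n| ≤ C * Real.exp (-(m * n))

/-- item stmt-QuantumFields-17756 · assembly · rank 1 · closed · proved by Summit.QuantumFields.YangMills.Theorems.doublingDefect_assembly_proof (prover) · by planner
sources: JaffeWitten2000, Luscher1977
[assembly] DoublingRecursion → OneTorusExit → RecursionToGap → NonSimplyConnectedLatticeGap →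
ContinuumLegGivenGap → YangMills. -/
@[route_item "route-QuantumFields-DoublingDefect"]
def Assembly : Prop :=
  DoublingRecursion → OneTorusExit → RecursionToGap → NonSimplyConnectedLatticeGap → ContinuumLegGivenGap → YangMills

-- `Assembly` holds: proved by `Summit.QuantumFields.YangMills.Theorems.doublingDefect_assembly_proof` (its module imports this route file, so no `_holds` link can be stated here).

/-! D-0027 §2.1 — DECIDING THEOREM (planner-authored via `route open/edit --closes-file`; by planner-rrepair-QuantumFields-DoublingDefect-s-bf971704-0 2026-08-17T02:36:50Z):
its hypotheses are this route's items and its conclusion the sub-problem Statement (glue_lint), and it elaborates with this file. -/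

/-- DECIDING THEOREM (D-0027 §2.1), pure logic: fix a compact simple `G` with its Borel σ-algebra;
`ContinuumLegGivenGap` (the shared existence leg, weak-coupling scheme `β_k → ∞`) reduces `YangMills` for
`G` to the volume-uniform weak-coupling lattice gap for every faithful unitary `r`; if `G` is simply
connected, the support `RecursionToGap` fed with `DoublingRecursion` and `OneTorusExit` (instantiated at
`G`, `r`) returns that body; otherwise the shared `NonSimplyConnectedLatticeGap` is the body.
Statement re-type 2026-08-16 (p116790): the new first conjunct `sch.HasWeakCouplingLimit` of `YangMills`
is part of the conclusion of `ContinuumLegGivenGap` (stmt-QuantumFields-15828) and is delivered by `hC`;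
this route builds no `∃`-witness of its own. Axioms: propext, Classical.choice, Quot.sound. -/
@[closes "route-QuantumFields-DoublingDefect"] theorem closes (hR : DoublingRecursion) (hE : OneTorusExit) (hG2 : RecursionToGap)
    (hN : NonSimplyConnectedLatticeGap) (hC : ContinuumLegGivenGap) : YangMills := by
  intro G _ _ _ _ hG
  letI : MeasurableSpace G := borel G
  haveI : BorelSpace G := ⟨rfl⟩
  refine hC G hG fun r => ?_
  by_cases hSC : SimplyConnectedSpace G
  · exact hG2 G hG hSC r (hR G hG hSC r) (hE G hG hSC r)
  · exact hN G hG hSC r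

end Summit.QuantumFields.YangMills.Theses.DoublingDefect
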